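import Literature.Analysis.FluidPDE.TaoCascadeReducedClaimProofs
import Literature.Analysis.FluidPDE.TaoCascadeRescaledStepOrder
import Literature.Analysis.FluidPDE.TaoCascadeBlowupDynamicsCorrected
import HarnessLib

/-!
# Tao's cascade ODE: Props. 6.15, 6.12, 6.5, 6.4, 6.3 and Thm. 6.2 hold (the discharge of `blowupDynamics`)

T. Tao, *Finite time blowup for an averaged three-dimensional Navier–Stokes equation*,
J. Amer. Math. Soc. **29** (2016), 601–674 = arXiv:1402.0290v3, §6 (Thm. 6.2, Props. 6.3–6.5,
6.12–6.17).

The last link: Prop. 6.15 in the packaging `ZeroScale.Setting` for `K ≥ 10¹⁸`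
(`ZeroScale.Setting.exists_nextState`, `TaoCascadeZeroScaleDrainFinal.lean`) discharges the regime
input `ReducedClaimIIInput` and the corrected Prop. 6.5 (`reducedClaimIIInput_holds`,
`rescaledStepCorrected'_holds`, `TaoCascadeReducedClaimProofs.lean`), hence Thm. 6.2 (`noGlobalODESolution`), the corrected Prop. 6.3
(`blowupDynamicsCorrected`) and — vacuously, through Thm. 6.2, see the module docstring of
`TaoCascadeRescaledStepOrder.lean` / `TaoCascadeBlowupDynamicsWith.lean` on the unpropagatable
printed threshold `10⁻⁵exp(-K¹⁰)` of (6.17) — the named facts `blowupDynamics` (Prop. 6.3 as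
printed) and `blowupDynamicsStep` (Prop. 6.4 as printed). Theorems only.

## References

* T. Tao, J. Amer. Math. Soc. 29 (2016), 601–674, arXiv:1402.0290v3, §6.2 Thm. 6.2, Prop. 6.3,
  §6.3 Prop. 6.4, §6.4 Prop. 6.5, §6.5 Prop. 6.12, §6.6 Prop. 6.15. [`Tao2016AveragedNS`]
* T. Tao, blog erratum to (6.17) (coefficient `10⁻⁵exp(-K¹⁰/2)`). [`TaoBlog2014AveragedNSErratum`]
-/

noncomputable section

namespace Literature.Analysis.FluidPDE

namespace TaoCascade

/-- **Thm. 6.2 (no global solutions of the cascade ODE)** holds.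
[cite: Tao2016AveragedNS, §6.2 Thm. 6.2] -/
theorem noGlobalODESolution_holds : noGlobalODESolution :=
  noGlobalODESolution_of_rescaledStepCorrected' rescaledStepCorrected'_holds

/-- **The corrected Prop. 6.3** (`blowupDynamicsCorrected`) holds.
[cite: Tao2016AveragedNS, §6.2 Prop. 6.3] -/
theorem blowupDynamicsCorrected_holds : blowupDynamicsCorrected :=
  blowupDynamicsCorrected_of_rescaledStepCorrected' rescaledStepCorrected'_holds

/-- **Prop. 6.3 as printed** (`blowupDynamics`) holds — vacuously, through Thm. 6.2
(`blowupDynamics_iff_noGlobalODESolution`): the cascade ODE has no global solution, so the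
hypothesis `TaoODESystem …` of the fact is never satisfied. [cite: Tao2016AveragedNS, §6.2 Prop. 6.3] -/
theorem blowupDynamics_holds : blowupDynamics :=
  (blowupDynamics_of_rescaledStepCorrected' rescaledStepCorrected'_holds).1

/-- **Prop. 6.4 as printed** (`blowupDynamicsStep`) holds (vacuously, through Thm. 6.2).
[cite: Tao2016AveragedNS, §6.3 Prop. 6.4] -/
theorem blowupDynamicsStep_holds : blowupDynamicsStep :=
  (blowupDynamics_of_rescaledStepCorrected' rescaledStepCorrected'_holds).2

end TaoCascade

end Literature.Analysis.FluidPDE
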